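import Literature.NumberTheory.EllipticCurves.Kato2004.AdmissibleZetaClass
import Literature.NumberTheory.EllipticCurves.AnalyticRank
import Literature.NumberTheory.EllipticCurves.PAdicHeights
import HarnessLib

/-!
# Non-vanishing at `p` of the `p`-adic Beilinson–Kato class of an elliptic curve of analytic rank one
# (the «weak» Perrin-Riou conjecture): Venerucci 2016 at a SPLIT multiplicative `p > 3`, and
# Bertolini–Darmon–Venerucci 2022 at an odd `p` with `p² ∤ N` — two NAMED FACTS in the tree's Kato currency

Topic `NumberTheory/EllipticCurves` (namespace = path). Written by the LEAD prover of crux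
stmt-BirchSwinnertonDyer-19715 (`ErratumRoadFive.EulerHalfNotRamNoInertSetAtFive`, line `kato_Fframe` r5.5), whose kernel closure
`Summits/…/Theorems/ErratumRoadFiveKatoFframeClosureAtomic.lean` (p766911) carries exactly these two printed non-vanishings as
HYPOTHESIS BINDERS (`hNZsplit`, `hNZnonsplit`); this file types them as named facts so that the binders are discharged by name.
DEFINITIONS ONLY (two `Prop`s, statement-only file); NO theorem, NO instance, NO notation, NO `sorry`; nothing
about Perrin-Riou's FORMULA (`log = ℓ·log²(P)`), the Iwasawa main conjecture or BSD is asserted.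

## The printed statements

* **[Venerucci2016]** R. Venerucci, *Exceptional zero formulae and a conjecture of Perrin-Riou*, Invent. math. 203 (2016)
  923–972 (= arXiv:1407.1913; store text `paper:arxiv-1407.1913`, re-read 2026-08-30, pp. 1, 3, 4). Setting (§1, p. 1): «Let
  `A` be an elliptic curve over `ℚ` of conductor `Np`, with `p > 3` a prime of split multiplicative reduction. … Assume
  throughout this paper that the `p`-torsion subgroup `A_p` of `A(ℚ̄)` is an irreducible `F_p[G_ℚ]`-module.» Kato's element
  `ζ^BK_∞ = (ζ^BK_n)_n ∈ H¹_Iw(ℚ_∞, T_p(A))` is pinned by `𝓛_A(res_p(ζ^BK_∞)) = L_p(A/ℚ)` (eq. (1)) and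
  `exp*_A(res_p(ζ^BK)) = (1 − p⁻¹)·L(A/ℚ,1)/Ω_A^+` (eq. (3)), `ζ^BK ∈ H¹(ℚ, V_p(A))` the image of `ζ^BK_0`.
  «**Theorem A.** Assume that `L(A/ℚ,1) = 0` … In particular: `res_p(ζ^BK) ≠ 0` if and only if `L(A/ℚ,s)` has a simple zero
  at `s = 1`.» (p. 3); «**Theorem B.** `ζ^BK` is non-zero if and only if `ord_{s=1} L(A/ℚ,s) ≤ 1`.» (p. 4).
* **[BertoliniDarmonVenerucci2022]** M. Bertolini, H. Darmon, R. Venerucci, *Heegner points and Beilinson–Kato elements: a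
  conjecture of Perrin-Riou*, Adv. Math. 398 (2022) 108172, Thm. A. The paper itself is CITE-ONLY in the store (acquisition
  request acq-02715, open); the statement typed here is its published TRANSCRIPTION [Kim2022] C.-H. Kim, *On the soft
  `p`-converse to a theorem of Gross–Zagier and Kolyvagin*, Math. Ann. 387 (2023) (= arXiv:2109.12344; store text
  `paper:arxiv-2109.12344` p. 5): «**Theorem 2.1 (Bertolini–Darmon–Venerucci).** Let `E` be an elliptic curve over `ℚ` of
  conductor `N` and `p` an odd prime with `p² ∤ N`. If `L(E,1) = 0`, then there exists a global point `P ∈ E(ℚ)` satisfying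
  the following properties. • The point `P` has infinite order if and only if `ord_{s=1} L(E,s) = 1`. • The following equality
  holds in `ℚ_p` up to multiplication by a non-zero rational number: `log_{ω_E}(res_p(z_Kato)) = (log_{ω_E}(P))²` …»,
  «**Corollary 2.3.** Under the setting of Theorem 2.1, the following statements are equivalent. • `ord_{s=1} L(E,s) = 1`.
  • `P` has infinite order. • `res_p(z_Kato)` is non-zero.» The same scope («`p ≥ 3`, `p² ∤ N`») is attributed to [BDV22] by
  [Kim2025RefinedTNC] Thm. 1.2 (rk1 + ε) (arXiv:2505.09121 p. 5) and by the zbMATH review Zbl 1495.11066 («semistable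
  reduction at `p`»); Burungale–Skinner–Tian–Wan (arXiv:2409.01350 p. 9) describe [BDV22] as «the good reduction case» — the
  narrower reading. THIS FILE TYPES KIM'S PRINTED TRANSCRIPTION (odd `p`, `p² ∤ N`); a reviewer holding [BDV22] should check
  its Thm. A hypotheses against `BertoliniDarmonVenerucci2022_kummerLog_bottomLayer_ne_zero` below and narrow it if needed.

## The transcription into the tree's currency (why the `Prop`s below say what the papers say)

(T1) `W.analyticRank = 1` is «`L(W/ℚ,s)` has a simple zero at `s = 1`» (`Literature/…/AnalyticRank.lean`), in particular
`L(W,1) = 0`, so the Beilinson–Kato class is a Selmer class (Kato's reciprocity law, [Venerucci2016] eq. (3)).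
(T2) THE CLASS. `Kato2004.IsAdmissibleZetaClass W p K hK I z₀` (tree file `Kato2004/AdmissibleZetaClass.lean`, module docstring
«HENCE, BY PRINT: `{z₀ admissible} = Λˣ·𝐳_{γ_W} ∩ I.H`», Kato Thm. 12.4 (2) + Rohrlich) says that `z₀ ∈ I.H = 𝐇¹_Γ(T_pW)` is,
up to a unit of `Λ = ℤ_p⟦Γ⟧`, Kato's `Ω_W`-normalised Λ-adic zeta element on the `Δ`-trivial component — the element whose
dual-exponential values at the (even) characters `χ` of `Γ` are `L_{(p)}(W, χ̄, 1)·(Gauss sum)/Ω_W^+`; this is Venerucci's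
`ζ^BK_∞` (eqs. (1)/(3): `𝓛_A ∘ res_p` of it is the Mazur–Tate–Teitelbaum `L_p(A/ℚ)`, [Kato2004Asterisque] Thm. 16.6) and Kim's
`z^∞_Kato` «Kato's zeta element over `ℚ_∞` (with respect to `T`)». Its BOTTOM LAYER `layerZeroToTop W p K (I.proj 0 z₀) ∈
H¹(ℚ, T_pW)` is therefore `u(𝟙)·ζ^BK_0` with `u(𝟙) ∈ ℤ_pˣ` (a unit of `Λ` acts on the layer-`0` projection through its
augmentation): NON-VANISHING STATEMENTS ARE INSENSITIVE TO THE NORMALISATION.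
(T3) THE LOGARITHM. `Kato2004.HasLocPKummerLog W p x t` (tree file `Kato2004/LocPKummerLog.lean`) says: for some integer `m ≠ 0`
and ONE point `Q ∈ E(ℚ_p)`, `loc_p(m·x)` is the local Kummer class of `Q` at every level `p^k` and `log_ω(Q) = m·t` — i.e.
«`loc_p(x) ⊗ 1 ∈ H¹_f(ℚ_p, V) = E(ℚ_p) ⊗̂ ℚ_p` (Bloch–Kato Ex. 3.11) with `log(loc_p x) = t`». On `E(ℚ_p) ⊗̂ ℚ_p` the
logarithm is an ISOMORPHISM onto `ℚ_p` ([Venerucci2016] p. 3: «`log_A = log_{q_A} ∘ Φ_Tate⁻¹` … the formal group logarithm …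
induces an isomorphism `log_A : A(ℚ_p) ⊗̂ ℚ_p ≅ ℚ_p`»; in general [BlochKato1990] Ex. 3.11; `log_A` and the tree's
Néron-normalised `log_ω = padicLogLocal` differ by a unit), so `res_p(class) ≠ 0` in `H¹_f(ℚ_p, V)` ⟺ every Kummer
logarithm `t` of the class is `≠ 0` (`m·u(𝟙)·log(res_p ζ^BK) = log_ω(Q) = m·t`, `m ≠ 0`).
(T4) Hence each printed «`res_p(Beilinson–Kato class) ≠ 0` when the zero of `L(E,s)` at `s = 1` is simple» reads, in tree
currency: for every admissible `z₀` of every pinned cyclotomic Iwasawa cohomology and every `t` with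
`HasLocPKummerLog W p (layerZeroToTop W p K (I.proj 0 z₀)) t`, `t ≠ 0` — the two `Prop`s below. SPECIAL CASES of print:
only the non-vanishing is typed, not the formulae `log = ℓ₁·log²(P)` (Venerucci Thm. A (1)) / `log ≐ log²(P)` (BDV Thm. A).

JUNK AUDIT. Not silently `⊤`: at `p = 2` `IsAdmissibleZetaClass` is empty by design, but both facts demand `p` odd, and for odd
`p` admissible classes EXIST under (12.5.2) (named fact `exists_isAdmissibleZetaClass_of_imageContainsSL2`, Kato Thm. 12.5 (4)),
and a Kummer logarithm of the bottom class EXISTS in positive rank (tree theorem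
`ErratumRoadFiveKatoFframeValueAtoms.exists_hasLocPKummerLog_bottomClass`); so the facts have content exactly on the curves the
papers treat. Not `⊥`: they are theorems in print. No statement at analytic rank `≠ 1` is made (the «only if» halves are not typed).

CONSUMER (Summits side, nothing of it asserted here): the binders `hNZsplit` / `hNZnonsplit` of
`ErratumRoadFiveKatoFframeClosureAtomic.{missingUpperBoundAt_of_atoms, eulerHalfNotRamNoInertSetAtFive_of_atoms}` follow from
the two facts in three lines each (`ρ̄` onto ⇒ `E[p]` irreducible, `hasIrreducibleModPGaloisRep_of_hasSurjectiveModNGaloisRep`;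
multiplicative ⇒ `f_p = 1` ⇒ `p² ∤ N`, `factorization_conductorNorm_eq_one_of_hasMultiplicativeReductionAtPrime`) — done in the
consumer file `Summits/…/Theorems/ErratumRoadFiveKatoFframeClosureOfPrint.lean`, not here.

References: [Venerucci2016] §1 (p. 1), eqs. (1)–(3), Thm. A, Thm. B (pp. 3–4); [BertoliniDarmonVenerucci2022] Thm. A;
[Kim2022] Thm. 2.1, Cor. 2.3 (p. 5); [Kim2025RefinedTNC] Thm. 1.2; [Kato2004Asterisque] Thm. 12.4 (2), Thm. 12.5 (pp. 221–222),
Thm. 16.6; [BlochKato1990] Def. 3.10, Ex. 3.11; [PerrinRiou1993AIF] §3.3 (the 1993 prediction); [BurungaleSkinnerTianWan2024]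
Conj. 1.12, Thm. 1.13 (the case `p ∤ 2N`, not typed here); tree: `Kato2004/AdmissibleZetaClass.lean`, `Kato2004/LocPKummerLog.lean`.
-/

noncomputable section

open scoped Classical

namespace Literature.NumberTheory.EllipticCurves

open Field
open Literature.NumberTheory.EllipticCurves.Kato2004

/-! ## §1 Venerucci 2016 — split multiplicative `p > 3` -/

/-- **Venerucci 2016, Thm. A (in-particular clause) with Thm. B — at a SPLIT multiplicative prime `p > 3` with `E[p]`
irreducible, the `p`-adic Beilinson–Kato class of an elliptic curve `E/ℚ` of analytic rank one is non-zero at `p`**, in the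
tree's Kato currency (module docstring (T1)–(T4)): for `W/ℚ` globally minimal, `3 < p`, `W` split multiplicative at `p` (so the
conductor is `Np` with `p ∤ N`), `ρ̄_{W,p}` irreducible and `ord_{s=1} L(W,s) = 1`, EVERY Kummer logarithm `t` at `p` of the
bottom layer `z_ℚ ∈ H¹(ℚ, T_pW)` of EVERY admissible zeta class `z₀` (Kato's `Ω_W`-normalised `𝐳_γ` up to `Λˣ`) of every
pinned cyclotomic Iwasawa cohomology `I` is `≠ 0`. Print: «Let `A` be an elliptic curve over `ℚ` of conductor `Np`, with
`p > 3` a prime of split multiplicative reduction … `A_p` … irreducible» [§1 p. 1]; «Theorem A. Assume that `L(A/ℚ,1) = 0`. …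
In particular: `res_p(ζ^BK) ≠ 0` if and only if `L(A/ℚ,s)` has a simple zero at `s = 1`.» [p. 3]; `log_A : A(ℚ_p) ⊗̂ ℚ_p ≅ ℚ_p`
[p. 3]. A SPECIAL CASE of print (the non-vanishing only; not the formula `log_A(res_p ζ^BK) = ℓ₁·log_A²(𝐏)` of Thm. A (1), not
Thm. B's «only if»). Named fact; nothing asserted; no `_holds` (XL: Hida families, the Bertolini–Darmon exceptional-zero formula,
Nekovář's Selmer complexes).
[cite: Venerucci2016, §1 (p. 1), eqs. (1)–(3), Thm. A and Thm. B (pp. 3–4) (arXiv:1407.1913)]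
[cite: Kato2004Asterisque, Thm. 12.4 (2) and Thm. 12.5 (pp. 221–222), Thm. 16.6] [cite: BlochKato1990, Def. 3.10 and Ex. 3.11] -/
def Venerucci2016_kummerLog_bottomLayer_ne_zero_split : Prop :=
  ∀ (W : WeierstrassCurve ℚ) [W.IsElliptic] [W.IsGloballyMinimal] (p : ℕ) [Fact p.Prime]
    [ContinuousSMul ℤ_[p] (W.tateModule p)],
    3 < p → W.HasSplitMultiplicativeReductionAtPrime p → W.HasIrreducibleModPGaloisRep p → W.analyticRank = 1 →
    ∀ (K : ZpExtension ℚ p) (hK : K.IsCyclotomic) (γ : absoluteGaloisGroup ℚ) (I : IwasawaH1Data W p K γ) (z₀ : I.H),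
      K.IsTopGenerator γ → IsAdmissibleZetaClass W p K hK I z₀ →
    ∀ t : ℚ_[p], HasLocPKummerLog W p (layerZeroToTop W p K (I.proj 0 z₀)) t → t ≠ 0

-- TODO(general form): Venerucci's Thm. A (1) `log_A(res_p(ζ^BK)) = ℓ₁·log_A²(𝐏)` with `ℓ₁ = −2ℓ·ord_p(q_A)·(1 − p⁻¹) ∈ ℚˣ`
-- (`ℓ`, `𝐏` from the Bertolini–Darmon formula on `X_{N⁺,pN⁻}`), Thm. B (`ζ^BK ≠ 0 ⟺ ord_{s=1} L ≤ 1`) and Thms. C–E.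

/-! ## §2 Bertolini–Darmon–Venerucci 2022 (transcription Kim 2022) — odd `p`, `p² ∤ N` -/

/-- **Bertolini–Darmon–Venerucci 2022, Thm. A, in the published transcription Kim 2022 Thm. 2.1 / Cor. 2.3 — at an odd prime
`p` with `p² ∤ N_E`, the `p`-adic Beilinson–Kato class of an elliptic curve `E/ℚ` of analytic rank one is non-zero at `p`**
(the non-vanishing Perrin-Riou predicted in 1993 — a THEOREM of [BDV22]), in the tree's Kato currency (module docstring
(T1)–(T4)): for `W/ℚ` globally minimal, `p ≠ 2`, `p² ∤ N_W` (`W.conductorNorm ℤ`; i.e. `W` has good or multiplicative reduction at `p`) and `ord_{s=1} L(W,s) = 1`,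
EVERY Kummer logarithm `t` at `p` of the bottom layer of EVERY admissible zeta class of every pinned cyclotomic Iwasawa
cohomology is `≠ 0`. Print (transcription): «Let `E` be an elliptic curve over `ℚ` of conductor `N` and `p` an odd prime with
`p² ∤ N`. If `L(E,1) = 0`, then there exists a global point `P ∈ E(ℚ)` … `P` has infinite order if and only if
`ord_{s=1} L(E,s) = 1` … `log_{ω_E}(res_p(z_Kato)) = (log_{ω_E}(P))²` up to multiplication by a non-zero rational number»
[Kim2022 Thm. 2.1, p. 5]; «Corollary 2.3. … equivalent: `ord_{s=1} L(E,s) = 1`; `P` has infinite order; `res_p(z_Kato)` is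
non-zero.» SCOPE FLAG `BDV22-scope@Kim22`: [BDV22]'s own text is cite-only in the store (acq-02715); the hypotheses typed are
Kim's (also [Kim2025RefinedTNC] Thm. 1.2, zbMATH Zbl 1495.11066 «semistable at `p`»); [BurungaleSkinnerTianWan2024] p. 9 call
[BDV22] «the good reduction case» — if [BDV22] Thm. A turns out to exclude multiplicative `p`, this `Prop` must be narrowed to
`W.HasGoodReductionAtPrime p` and its multiplicative consumers withdrawn. A SPECIAL CASE of print (the non-vanishing
only). Named fact; nothing asserted; no `_holds` (XL).
[cite: BertoliniDarmonVenerucci2022, Thm. A] [cite: Kim2022, Thm. 2.1 and Cor. 2.3 (arXiv:2109.12344 p. 5)]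
[cite: Kim2025RefinedTNC, Thm. 1.2 (rk1 + ε) (arXiv:2505.09121 p. 5)] [cite: Kato2004Asterisque, Thm. 12.4 (2) and Thm. 12.5 (pp. 221–222)]
[cite: BlochKato1990, Def. 3.10 and Ex. 3.11] -/
def BertoliniDarmonVenerucci2022_kummerLog_bottomLayer_ne_zero : Prop :=
  ∀ (W : WeierstrassCurve ℚ) [W.IsElliptic] [W.IsGloballyMinimal] (p : ℕ) [Fact p.Prime]
    [ContinuousSMul ℤ_[p] (W.tateModule p)],
    p ≠ 2 → ¬ p ^ 2 ∣ W.conductorNorm ℤ → W.analyticRank = 1 →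
    ∀ (K : ZpExtension ℚ p) (hK : K.IsCyclotomic) (γ : absoluteGaloisGroup ℚ) (I : IwasawaH1Data W p K γ) (z₀ : I.H),
      K.IsTopGenerator γ → IsAdmissibleZetaClass W p K hK I z₀ →
    ∀ t : ℚ_[p], HasLocPKummerLog W p (layerZeroToTop W p K (I.proj 0 z₀)) t → t ≠ 0

-- TODO(general form): [BDV22] Thm. A in full — the point `P ∈ E(ℚ)` with `P` of infinite order ⟺ `ord_{s=1} L(E,s) = 1` and
-- `log_{ω_E}(res_p z_Kato) ≐ log_{ω_E}(P)²` up to `ℚˣ` (Perrin-Riou's 1993 prediction, rational form), once the store holds the text.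

end Literature.NumberTheory.EllipticCurves

end
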